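import Literature.NumberTheory.Weil1964.ArchLeviKAKInput
import Literature.RepresentationTheory.KonnoKonno2007.JunctionTwoPlanes
import Literature.RepresentationTheory.KonnoKonno2007.RealUnitaryKAKPair
import HarnessLib

/-!
# Levi-family `KAK` input of the real unitary dual pair `U(P,Q) × U(R,S)` in real rank TWO (two disjoint planes)

Topic `NumberTheory/Weil1964`; namespace `Literature.NumberTheory.Weil1964`.  ONE definition with body
(`LeviKAKInput.junctionTwo`, a structure instance — data), no record, no `Prop`-valued definition, no hypothesis of
print; the companion theorem restates its output.  Continuation of ★ `ArchLeviKAKInput` §4, whose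
`LeviKAKInput.junction p₀ q₀ [Subsingleton Q]` is the case of a FIRST factor of real rank ONE: here the first factor
has real rank TWO — two disjoint hyperbolic planes `{e_{p₀}, e_{q₀}}`, `{e_{p₁}, e_{q₁}}` exhausting `P` or `Q`
(`U(2,2)`, `U(p,2)`, `U(2,q)`), the second factor compact (`kV R S` onto).

The eleven fields: `map_mul`, `ιK = dualPairι`, `continuous_ιK`, `hreal` exactly as in the rank-one instance; the
`A`-part `a_t = (hypV p₀ q₀ t₁ · hypV p₁ q₁ t₂, 1)`, `t ∈ ℝ × ℝ`, in Levi form with the COMMON Siegel frame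
`U = frameU p₀ q₀ · frameU p₁ q₁` and the product dilation `L t = δ₀(e^{t₁}) δ₁(e^{t₂})` (★ `JunctionTwoPlanes`:
`hypPhase_two_eq_conj_leviPhase` for `hγA`, `planeDil_mul_dotProduct_symm` for `had`, `continuous_planeDil_mul_exp_symm`
for `hL`); the word fields `isProperMap_word` / `word_surjective` are ★ `RealUnitaryKAKPair.isProperMap_kakWordPairTwo` /
`kakWordPairTwo_surjective` (the Cartan decomposition `U(p,2) = K A K` with a proper word, [Knapp2002, Thm 7.39], over
★ `RealUnitaryKAK`).  Output: `(LeviKAKInput.junctionTwo …).kakImplementerData` — vacuum-normalisable `KAK` implementer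
data, hence the hypotheses (w0)–(w2) of the archimedean theta-majorant theorem at a real place of signature `(2,2)`
(consumer: the CM pin `hasThetaMajorants_cmPairSplitting_rankTwo` of the doubled pair `(U(2,2), U(1))`, KAK-U22 (iii)).

References: [Folland1989] G. B. Folland, *Harmonic Analysis in Phase Space*, Princeton UP 1989, §4.2 (4.24) p. 156,
Prop. (4.39); [Knapp2002] A. W. Knapp, *Lie Groups Beyond an Introduction*, 2nd ed., Birkhäuser 2002, Thm 7.39;
[KonnoKonno2007] K. Konno, T. Konno, Kyushu J. Math. 61 (2007) §3.1 (3.1); [MoeglinVignerasWaldspurger1987] Ch. 1 I.17.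
-/

noncomputable section

open MeasureTheory Complex SchwartzMap Matrix
open scoped InnerProductSpace ComplexConjugate Real

namespace Literature.NumberTheory.Weil1964

open Literature.Analysis.SegalBargmann Literature.RepresentationTheory.HeisenbergGroup
open Literature.RepresentationTheory.KonnoKonno2007

section RealDualPairTwo

open Literature.NumberTheory.Automorphic Literature.NumberTheory.Automorphic.UnitaryGroup
open Literature.RepresentationTheory.KonnoKonno2007.RealDualPair

variable {P Q R S : Type*} [Fintype P] [DecidableEq P] [Fintype Q] [DecidableEq Q] [Fintype R]
  [DecidableEq R] [Fintype S] [DecidableEq S]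

/-- **The pair `U(P,Q) × U(R,S)` with the FIRST factor of real rank two and `U(R) × U(S) → U(R,S)` onto**, in Levi
form: two disjoint hyperbolic planes `(p₀,q₀)`, `(p₁,q₁)` exhausting `P` or `Q`; common Siegel frame
`frameU R S p₀ q₀ · frameU R S p₁ q₁`, product dilation `planeDil R S p₀ q₀ (e^{t₁}) · planeDil R S p₁ q₁ (e^{t₂})` over
`a_t = (hypV p₀ q₀ t₁ · hypV p₁ q₁ t₂, 1)` (`JunctionTwoPlanes.hypPhase_two_eq_conj_leviPhase`), compact part `dualPairι`,
proper surjective word (`RealUnitaryKAKPair.isProperMap_kakWordPairTwo`, `kakWordPairTwo_surjective`).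
[cite: KonnoKonno2007, §3.1 (3.1); Folland1989, §4.2 (4.24), Prop. (4.39); Knapp2002, Thm 7.39] -/
def LeviKAKInput.junctionTwo (p₀ p₁ : P) (q₀ q₁ : Q) (hp : p₀ ≠ p₁) (hq : q₀ ≠ q₁)
    (hPQ : (∀ a : P, a = p₀ ∨ a = p₁) ∨ (∀ b : Q, b = q₀ ∨ b = q₁)) (hW : Function.Surjective (UForm.kV R S)) :
    LeviKAKInput
      (fun g : Ginf P Q R S =>
        (⇑((ι𝕎 P Q R S g).1 : ((DPIdx P Q R S → ℝ) × (DPIdx P Q R S → ℝ)) ≃ₗ[ℝ] ((DPIdx P Q R S → ℝ) × (DPIdx P Q R S → ℝ))) : PhaseMap (DPIdx P Q R S)))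
      (κ P Q R S)
      (fun t : ℝ × ℝ => (((hypV p₀ q₀ t.1 * hypV p₁ q₁ t.2 : UForm P Q), (1 : UForm R S)) : Ginf P Q R S)) where
  map_mul := symplecticPhaseMap_mul (ι𝕎 P Q R S)
  ιK := dualPairι
  continuous_ιK := continuous_dualPairι
  hreal k pq := ι𝕎_κ_apply R S k pq
  U := frameU R S p₀ q₀ * frameU R S p₁ q₁
  L t := planeDil R S p₀ q₀ (Real.exp t.1) (Real.exp_pos t.1).ne' * planeDil R S p₁ q₁ (Real.exp t.2) (Real.exp_pos t.2).ne'
  Ld t := (planeDil R S p₀ q₀ (Real.exp t.1) (Real.exp_pos t.1).ne' *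
    planeDil R S p₁ q₁ (Real.exp t.2) (Real.exp_pos t.2).ne').symm
  had _ x y := planeDil_mul_dotProduct_symm R S p₀ p₁ q₀ q₁ _ _ _ _ x y
  hL := continuous_planeDil_mul_exp_symm R S p₀ p₁ q₀ q₁
  hγA t pq := hypPhase_two_eq_conj_leviPhase R S p₀ p₁ q₀ q₁ hp hq t pq
  isProperMap_word := isProperMap_kakWordPairTwo p₀ p₁ q₀ q₁ hp hq
  word_surjective := kakWordPairTwo_surjective p₀ p₁ q₀ q₁ hp hq hPQ hW

/-- **The output at a real place of signature `(p,2)`/`(2,q)`**: vacuum-normalisable `KAK` implementer data of the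
symplectic action of `U(P,Q) × U(R,S)` with compact part `μ₀ ∘ dualPairι` and `A`-part
`t ↦ μ₀(U)⁻¹ ∘ leviS (δ₀(e^{t₁}) δ₁(e^{t₂})) ∘ μ₀(U)`, `U = frameU p₀ q₀ · frameU p₁ q₁` — hence (★ `KAKImplementerData`)
the canonical vacuum section is non-zero, jointly continuous and Heisenberg-covariant: the hypotheses (w0)–(w2) of the
archimedean theta-majorant theorem. [cite: Folland1989, §4.2 (4.24), Prop. (4.39); Knapp2002, Thm 7.39] -/
theorem LeviKAKInput.kakImplementerData_junctionTwo (p₀ p₁ : P) (q₀ q₁ : Q) (hp : p₀ ≠ p₁) (hq : q₀ ≠ q₁)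
    (hPQ : (∀ a : P, a = p₀ ∨ a = p₁) ∨ (∀ b : Q, b = q₀ ∨ b = q₁)) (hW : Function.Surjective (UForm.kV R S)) :
    KAKImplementerData
      (fun g : Ginf P Q R S =>
        (⇑((ι𝕎 P Q R S g).1 : ((DPIdx P Q R S → ℝ) × (DPIdx P Q R S → ℝ)) ≃ₗ[ℝ] ((DPIdx P Q R S → ℝ) × (DPIdx P Q R S → ℝ))) : PhaseMap (DPIdx P Q R S)))
      (κ P Q R S)
      (fun t : ℝ × ℝ => (((hypV p₀ q₀ t.1 * hypV p₁ q₁ t.2 : UForm P Q), (1 : UForm R S)) : Ginf P Q R S))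
      (fun k => unitaryOpPi (dualPairι k))
      (fun t : ℝ × ℝ => (unitaryOpPi (frameU R S p₀ q₀ * frameU R S p₁ q₁)⁻¹).comp
        ((leviS (planeDil R S p₀ q₀ (Real.exp t.1) (Real.exp_pos t.1).ne' *
            planeDil R S p₁ q₁ (Real.exp t.2) (Real.exp_pos t.2).ne')).comp
          (unitaryOpPi (frameU R S p₀ q₀ * frameU R S p₁ q₁)))) :=
  (LeviKAKInput.junctionTwo p₀ p₁ q₀ q₁ hp hq hPQ hW).kakImplementerData

end RealDualPairTwo

end Literature.NumberTheory.Weil1964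

end
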